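import Summits.QuantumFields.BalabanUV.T4Continuum.Support.ShellMeasureLandauEndAssembledToy
import Summits.QuantumFields.BalabanUV.T4Continuum.Support.ShellMeasureLandauEndBlockSpace

/-!
# `T4Continuum.ShellMeasureLandauEndAssembledBlockP4` — row S77 f7 (R10, file 2 of 2): «(P4) JOINTLY» — THE MOST-ASSEMBLED END OF
# RECORD APPLIED WITH (T1) := THE BLOCK FIELD SPACE AND `hW` := OUR ACTION'S BINDER (referee NE7c PASS 22 open item «(P4) joint
# inhabitation by OUR action»; t4-ref2 C-t4r2-386 caveat (ii) «`hW` inhabited only by the trivial `W𝒱 = 0`»)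
(cell `pub-balaban`, sub-cell `t4`, spine estimate NE7c (node U5b); NE7c ROUND-2 crew, unit
`b2b-balaban-t4-ne7c-formalise-leaf-02` gen 10; journal OFFER l.19686 («S77 f7 R9∕R10»); ADDITIVE — imports S80 f4
`ShellMeasureLandauEndAssembledToy` (leaf-01-g8: `norm_kerOp_zero_le`; hence S80 f3 `ShellMeasureLandauEndRayStokesAssembledDecay` —
leaf-09-g12's most-assembled END `slotAC_realized_su2_landauChart_assembled_decay` p229913 — and S88 `ShellMeasureLandauEndFinalToy` —
leaf-04-g7's one-plaquette `SU(2)` model `b₁`, `toyCentre`, `toyF`, `toyU`, `toyReadOut`, `toyJco` and lemmas, ALL BY NAME) and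
file 1 `ShellMeasureLandauEndBlockSpace` (this lineage: `𝕐`, `𝕎`, `blockW`, `blockW_prop4Hyp`, `embL`, `rdL`, `𝒢L`, `εθ₁`) ONLY;
[folklore]; 0 `def`, 0 `def … : Prop`, 0 sorry, 0 citation tags)

HONEST FRAMING.  A CONSISTENCY CERTIFICATE (rule G-1) — the TYPE-LEVEL JOINT INHABITATION of the ≈ 230-binder hypothesis list of
the most-assembled live-level END with the (P4) letter `hW` inhabited by OUR η-scaled cubic action's block functional instead of
`W𝒱 = 0`; nothing about Bałaban's minimiser, propagators, kernels or densities.  Finite four-torus programme, rung (B)+1 only — NOT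
infinite volume, NOT a mass gap, NOT the Clay problem, NOT summit progress; NE7c (`T4IndicatorShell.ShellWeightBound`) NOT PRINTED,
NOT PROVED; «NE7c ⇐ the named binders» (c3); (M1) realized on a toy ≠ NE7c.  HONEST DEPENDENCY (cell): continuum YM on T⁴ ⇐
BetaPertH ∧ nine spine estimates (0/9 proved); BetaPertH ⇐ (D1) ∧ (D4) ∧ CAP+tail; G-an2-4 gates asym, D1 and NE2/3/4.

WHY (referee NE7c PASS 22, REFEREE.md «S77 f6 ROAD F» reading (ii) + open items l.33; t4-ref2 pass 82 C-t4r2-386 caveat (ii)).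
S80 f4 `ShellMeasureLandauEndAssembledToy.slotAC_assembled_decay_toy` (leaf-01-g8) met rule G-1 for the END of record with the (T1)
letter `W𝒱 = 0`; R7 `ShellMeasurePlaquetteCubicFrozenBlock.prop4Hyp_pinned_ord₃_eta_levels_frozen_block` (this lineage) typed the
(P4) binder of OUR action ON THE BLOCK FIELD SPACE but no file applied it AS that `hW` TOGETHER WITH the other (T1) slot binders
(`𝒢`, `H₁`, `Φ`, `Cf`, `ιs`, `Hop`, the read-outs `ℓs`, the real structure, the dictionary) ON THE SAME `𝒴∕𝒵`.  THIS FILE: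
* **`slotAC_assembled_decay_blockP4_lit`** ∕ **`slotAC_assembled_decay_blockP4`**: S80 f3 APPLIED BY NAME with `𝒴 := 𝕐 d η`,
  `𝒵 := 𝕎 d`, **`W𝒱 V := blockW d η`, `hW V := blockW_prop4Hyp`** (`C₄ := C₄c d` the ORIGINAL stencil constant, `a₃ := 1∕8`),
  **`𝒢 V := 𝒢L d η (B₀η∕2)` NON-ZERO** (so B11 Prop. 6's fixed point `solAt 𝒢 0 blockW ε₄ 0 𝔄` is a GENUINE solution fed by OUR
  `blockW` — `rdL_solAt_eq_zero`: the chart read-out does not see it), `Cf := 0`, `ιs := 0`, `Hop := 0`, and — NOT degenerate —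
  `H₁ V := (B₀∕E₀) • embL`, `Φ V := (E₀∕B₀) • id`
  (`B₀ = 1∕(C₄c d + 1)`, `E₀ = 6∕η`, `r_Φ = η∕192`, `ε₄ = 1∕32`, `ε₁ = (C₄c d + 1)∕64`, `ε₃ = 1∕16`: the B11 Prop. 6 smallness list
  `h1`∕`h2`∕`h3`∕`hcoup` holds WITH OUR `C₄`), read-out `ℓs () := [rdL]` (`κ_r = κ_c = 1`, `m = 1`), S88's GENUINE dictionary
  (`hudict`: the tested variable `toyU p` = plaquette distance READ THROUGH `𝕐` — `rdL (H₁ (Φ (cplx x))) = gen x`; `hRdict`; co-test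
  `toyJco`; covariant centre; `T = ∅`; `F = toyF S p ≠ 0`) VERBATIM, (T2)∕(T3)∕(S78) := S80 f4's degenerate-but-legal data VERBATIM,
  the Stokes tail with `c₁ := 1∕(16η²)`, `c₂ := 1∕(16η)`, `z := 1` and the threshold `εθ₁ S η` making (SM) an EQUALITY; window
  `0 < S < η∕192`, depth `0 ≤ ρ ≤ ¼`, every `d ≥ 2` (`d = 4`: the live dimension), every `0 < η ≤ 1`.  Conclusion: (M1) for the toy
  slot, literal slot constant (`_lit`) and clean `4·m₀`.  If some (T1) letter could NOT live on the block space next to our `hW`,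
  that would have been a FINDING; none arose.
WHAT THIS DOES NOT DO: exercise (T2)∕(T3) (caveat (i) of C-t4r2-386 stands — zero kernels); exercise (T1)'s Landau correction
(`Cf = 0`, `Hop = 0`); make the slot LIVE at the threshold (S88 f2's measure half is orthogonal); give the read-out data Bałaban's
η-scalings (ONE slot: `c₁`, `c₂` absorb `η⁻²`, `η⁻¹` — the family-level lift is S95's business, F-ne7cp1-g34-1); discharge anything
of Bałaban's.  NOTHING in the countdown moves.
-/

noncomputable section

open Set Metric NormedSpace MeasureTheory Function

namespace Summit.QuantumFields.BalabanUV.T4Continuum.ShellMeasureLandauEndAssembledBlockP4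

open scoped ENNReal Matrix.Norms.L2Operator
open Literature.MathematicalPhysics.QuantumFieldTheory.Balaban1983to89
open B11Prop6Scheme (Prop4Hyp)
open GaugeField (GaugeInvariant plaqHol)
open T4ShellMeasure (SlotAntiConcentration)
open T4CubePoincare (cube mem_cube_iff)
open T4CubeChartGnomonic (SU2)
open T4CubeChartExp (expPt expFibreChart)
open T4TreeGaugeFixing (NoClosedLoop fixTo noClosedLoop_empty fixTo_empty)
open T4ExpWindowSmallField (dist1_expPt_eq dist1_eq_norm_coe_sub_one)
open T4ShellMeasurePlaquette (expTail₂)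
open ShellMeasureLevelAssembly (classifier)
open ShellMeasureWilsonWords (wordExp wordExp_cons wordExp_nil)
open ShellMeasureMultiGridNorms (WSup)
open ShellMeasurePinnedNorm (pinW)
open ShellMeasureDecayKernelSums (kerOp kerOp_apply)
open ShellMeasureLandauHolonomy (solAt landauExp)
open ShellMeasureLandauHolonomyChart (holOf cplx holOf_apply)
open ShellMeasureLandauHolonomySkew (readOutReal)
open ShellMeasureWilsonRealizedSU2 (M₂ gen coe_chart gen_mem_skewAdjoint)
open ShellMeasureLandauEndFinalToy (b₁ toyCentre toyF toyU toyReadOut toyJco measurable_toyF measurable_toyU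
  gaugeInvariant_toyF gaugeInvariant_toyU toyF_le_one toyF_one toyF_supp norm_toyReadOut_le toyReadOut_cplx solAt_zero
  landauExp_zero smul_mem_cube toyF_section_mono dist1_plaqHol_section)
open ShellMeasureLandauEndRayStokesAssembledDecay (slotAC_realized_su2_landauChart_assembled_decay)
open ShellMeasureLandauEndAssembledToy (norm_kerOp_zero_le)
open ShellMeasureLandauEndBlockSpace (𝕐 𝕎 blockW C₄c C₄c_nonneg blockW_prop4Hyp embL rdL 𝒢L rdL_embL rdL_𝒢L norm_rdL_le
  norm_embL_le norm_𝒢L_le real_smul_mem_skewAdjoint εθ₁ εθ₁_pos)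
open ShellMeasureLandauHolonomyChart (norm_cplx_le)
open B11Prop6Scheme (mapT_apply existsUnique_solution)
open ShellMeasureLandauHolonomy (solAt_spec)


/-! ## §3 THE MOST-ASSEMBLED END APPLIED WITH `hW` := OUR BLOCK (P4) BINDER -/

section End

variable {P : Params} {j : ℕ}

/-- **THE CHART READ-OUT NEVER SEES THE MINIMISER CORRECTION.**  With the NON-ZERO propagator letter `𝒢L d η s` (writing on the
second moving bond only), B11 Prop. 6's fixed point `solAt 𝒢 0 W ε₄ 0 𝔄` — a GENUINE solution (`existsUnique_solution` under the
scheme's numbers WITH OUR `W`'s (P4) binder, then `solAt_spec`) — satisfies `solAt = −𝒢 0 − 𝒢 (W (solAt + 𝔄))` (`mapT_apply`,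
`Λ = 0`), hence `rdL (solAt …) = 0` (`rdL_𝒢L`). [folklore] -/
theorem rdL_solAt_eq_zero (d : ℕ) [NeZero d] (h01 : (0 : Fin d) ≠ 1) {η s : ℝ}
    {W : 𝕐 d η → 𝕎 d} {B₀ C₄ a₃ a ε₄ : ℝ} (h𝒢 : ∀ f, ‖𝒢L d η s f‖ ≤ B₀ * ‖f‖) (hW : Prop4Hyp W C₄ a₃) (hB₀ : 0 ≤ B₀)
    (hC₄ : 0 ≤ C₄) {𝔄 : 𝕐 d η} (h𝔄 : ‖𝔄‖ < a) (hε₄ : 0 ≤ ε₄) (hdom : 2 * (ε₄ + a) ≤ a₃)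
    (hself : B₀ * C₄ * (ε₄ + a) ^ 2 ≤ ε₄) (hcontr : 4 * B₀ * C₄ * (ε₄ + a) < 1) :
    rdL d η (solAt (𝒢L d η s) 0 W ε₄ (0 : 𝕎 d) 𝔄) = 0 := by
  have hΛ : ∀ Y : 𝕐 d η, ‖(0 : 𝕐 d η →L[ℂ] 𝕐 d η) Y‖ ≤ 0 * ‖Y‖ := fun Y => by
    rw [zero_apply, norm_zero, zero_mul]
  have hJ : ‖(0 : 𝕎 d)‖ ≤ 0 := (norm_zero (E := 𝕎 d)).le
  have hself' : B₀ * 0 + 0 * (ε₄ + a) + B₀ * C₄ * (ε₄ + a) ^ 2 ≤ ε₄ := by simpa using hself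
  have hcontr' : 0 + 4 * B₀ * C₄ * (ε₄ + a) < 1 := by simpa using hcontr
  obtain ⟨X, ⟨hX, hfix⟩, -⟩ := existsUnique_solution (𝒢 := 𝒢L d η s) (Λ := (0 : 𝕐 d η →L[ℂ] 𝕐 d η)) (θ := 0)
    (W := W) h𝒢 hΛ hW.quadAnalytic hB₀ hC₄ le_rfl hJ h𝔄 hε₄ hdom hself' hcontr'
  have h := (solAt_spec (𝒢 := 𝒢L d η s) (Λ := (0 : 𝕐 d η →L[ℂ] 𝕐 d η)) (W := W) (ε₄ := ε₄) (J := (0 : 𝕎 d)) (𝔄 := 𝔄)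
    ⟨X, hX, hfix⟩).2
  rw [← h, mapT_apply, map_sub, map_add, map_neg, rdL_𝒢L d h01, rdL_𝒢L d h01, zero_apply, map_zero]
  simp

/-- **«(P4) JOINTLY» — THE MOST-ASSEMBLED END OF RECORD WITH (T1) ON THE BLOCK FIELD SPACE AND `hW` := OUR ACTION'S BINDER
(literal slot constant).**  For every lattice `P`, level `j`, plaquette `p`, enumeration `e` of the block `{b₁ p}`'s `3` chart
coordinates, dimension `d ≥ 2`, fine scale `0 < η ≤ 1`, window `0 < S < η∕192` and depth `0 ≤ ρ ≤ ¼`: S80 f3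
`ShellMeasureLandauEndRayStokesAssembledDecay.slotAC_realized_su2_landauChart_assembled_decay` APPLIED BY NAME with
`𝒴 := 𝕐 d η`, `𝒵 := 𝕎 d`, `W𝒱 V := blockW d η`, `hW V := blockW_prop4Hyp` (`C₄ := C₄c d`, `a₃ := 1∕8`) and the rest of (T1)
ON THE SAME SPACES (`𝒢 = 𝒢L d η (B₀η∕2)` NON-ZERO — the minimiser correction is a genuine fixed point fed by OUR `blockW`,
invisible to the read-out; `Cf = 0`, `ιs = 0`, `Hop = 0`; `H₁ = (B₀∕E₀)•embL`, `Φ = (E₀∕B₀)•id`, `ℓs () = [rdL]`; S88's genuine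
`F`∕`u`∕`Jco`∕centre∕dictionary), (T2)∕(T3)∕(S78) S80 f4's degenerate-but-legal data verbatim — EVERY binder met, none left as a
hypothesis.  A consistency certificate; nothing of Bałaban's; NE7c NOT PROVED. [folklore] -/
theorem slotAC_assembled_decay_blockP4_lit [DecidableEq (PBond P j)] (p : Plaq P j) {m₀ : ℕ}
    (e : ↥({b₁ p} : Finset (PBond P j)) × Fin 3 ≃ Fin m₀) (d : ℕ) [NeZero d] (hd2 : 2 ≤ d) {η S ρ : ℝ} (hη : 0 < η)
    (hη1 : η ≤ 1) (hS : 0 < S) (hSη : S < η / 192) (hρ0 : 0 ≤ ρ) (hρ4 : ρ ≤ 1 / 4) :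
    SlotAntiConcentration ((fieldMeasure P j SU2).withDensity (toyF S p)) (toyU p) (εθ₁ S η * η ^ 2) ρ
      (2 * ((m₀ : ℝ) + (3 * (|(0:ℝ)| * ((0 +
                2 * (1 * (0 * 1 * (1/6) / ((1 - 0 * 1 * (2 * 0 * (2/3) * Real.exp (0 * 0))) *
                    (1 - 2 * 0 * 2 * Real.exp (0 * 0) * (0 * 1) * (0 * 1)))) +
                  expTail₂ (((1:ℕ):ℝ) * (1 * (0 * 1 * (1/6) / ((1 - 0 * 1 * (2 * 0 * (2/3) * Real.exp (0 * 0))) *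
                    (1 - 2 * 0 * 2 * Real.exp (0 * 0) * (0 * 1) * (0 * 1))))))) / ((1/3) / S)) *
                (2 * (1 * (0 * 1 * (1/6) / ((1 - 0 * 1 * (2 * 0 * (2/3) * Real.exp (0 * 0))) *
                    (1 - 2 * 0 * 2 * Real.exp (0 * 0) * (0 * 1) * (0 * 1)))) +
                  expTail₂ (((1:ℕ):ℝ) * (1 * (0 * 1 * (1/6) / ((1 - 0 * 1 * (2 * 0 * (2/3) * Real.exp (0 * 0))) *
                    (1 - 2 * 0 * 2 * Real.exp (0 * 0) * (0 * 1) * (0 * 1))))))) / ((1/3) / S))) * 1) +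
              (3 * (0 * (2 * (((1/6) + 1 * (1/6)) + 1 * (4 * 0 * ((1/6) + 1 * (1/6)) ^ 2)))) / ((1/3) / S - 1) + 0))) / (1 - 1/2)) := by
  have hd1 : 1 ≤ d := by omega
  have h01 : (0 : Fin d) ≠ 1 := by
    intro h
    have h' := congrArg Fin.val h
    rw [Fin.val_zero, Fin.val_one', Nat.mod_eq_of_lt (by omega)] at h'
    exact absurd h' (by norm_num)
  have hS6 : S < 1 / 6 := by linarith
  have hSπ : 3 * S ^ 2 < Real.pi ^ 2 := by nlinarith [Real.pi_gt_three]
  have hC := C₄c_nonneg d hd1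
  have hs0 : 0 ≤ 1 / (C₄c d + 1) * η / 2 := by positivity
  have h𝒢B : ∀ f : 𝕎 d, ‖𝒢L d η (1 / (C₄c d + 1) * η / 2) f‖ ≤ 1 / (C₄c d + 1) * ‖f‖ := fun f =>
    (norm_𝒢L_le d hη hη1 hs0 f).trans (le_of_eq (by field_simp))
  have hC1 : 0 < C₄c d + 1 := by linarith
  have hB₀ : 0 < 1 / (C₄c d + 1) := by positivity
  have hE₀ : 0 < 6 / η := by positivity
  have hRad : 1 < (η / 192) / S := by rw [lt_div_iff₀ hS]; linarith
  -- the two displayed scalings: `H₁ = (B₀∕E₀)•embL`, `Φ = (E₀∕B₀)•id`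
  refine slotAC_realized_su2_landauChart_assembled_decay (P := P) (j := j) (n := Fin 2)
    (𝒴 := 𝕐 d η) (𝒴' := 𝕐 d η) (𝒳 := Fin m₀ → ℂ) (𝒵 := 𝕎 d) (ℬ := Fin m₀ → ℂ)
    (T := ∅) noClosedLoop_empty 1 {b₁ p} e hS hSπ (toyCentre p) (measurable_toyF S p) (gaugeInvariant_toyF S p)
    (toyF_supp S p 1) (measurable_toyU p) (gaugeInvariant_toyU p) (ι := Unit) (Pu := {()})
    (Finset.singleton_nonempty ()) (fun _ => cube m₀ S) (toyJco S p e) (δ := 1 / 2) (ρ := ρ) (β := 0)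
    -- ══ (T1) ON THE BLOCK SPACE: `𝒢 := 𝒢L` (NON-ZERO), `W𝒱 := blockW`, `hW := blockW_prop4Hyp` ══
    (fun _ => 𝒢L d η (1 / (C₄c d + 1) * η / 2)) (fun _ => blockW d η) (B₀ := 1 / (C₄c d + 1)) (C₄ := C₄c d)
    (a₃ := 1 / 8) (ε₄ := 1 / 32) (fun _ f => h𝒢B f)
    (fun _ => blockW_prop4Hyp d hd1 hη hη1) hB₀ hC (by norm_num)
    (dL := 1) (C₁ := 1) (B₃ := 1) (ε₁ := (C₄c d + 1) / 64) zero_le_one zero_le_one (by positivity) le_rfl ?_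
    (by norm_num) ?_
    (fun _ => (((1 / (C₄c d + 1)) / (6 / η) : ℝ) : ℂ) • embL d p e η) ?_
    (fun _ z => (((6 / η) / (1 / (C₄c d + 1)) : ℝ) : ℂ) • z) (rΦ := η / 192)
    (fun _ => ((((((6 / η) / (1 / (C₄c d + 1)) : ℝ) : ℂ) •
        ContinuousLinearMap.id ℂ (Fin m₀ → ℂ)).differentiable.differentiableOn).congr fun z _ => rfl))
    (fun _ => smul_zero _) ?_ hSη
    (fun _ _ => 0) (C₂ := 0) (RC := 1) le_rfl (fun _ Z _ => by simp) (fun _ => differentiableOn_const _)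
    (fun _ => 0) (fun _ Y => by simp) (fun _ => 0)
    (fun _ X => by rw [zero_apply, norm_zero]; exact mul_nonneg hB₀.le (norm_nonneg X))
    (ε₃ := 1 / 16) (by norm_num) ?_ (by norm_num)
    (fun _ => [rdL d η]) (κr := 1) zero_le_one
    (fun _ _ ℓ hℓ Y => by rw [List.mem_singleton.1 hℓ, one_mul]; exact norm_rdL_le d η Y) (m := 1)
    (fun _ _ => by simp) (κc := 1) zero_le_one
    (fun _ _ Y => by simpa using norm_rdL_le d η Y)
    -- ══ (T2): S80 f4's degenerate-but-legal data VERBATIM ══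
    (Λw := Unit) (Λz := Unit) (Λw' := Unit) (Λx := Unit) (Λb := Unit) (𝔖 := Unit)
    (𝔄w := ℂ) (ℭ := ℂ) (𝔄' := ℂ) (𝔅 := ℂ) (𝔇 := ℂ)
    (δw := 0) le_rfl (fun _ => 0) (fun _ _ => 0) (fun _ _ => by simp) id id id id id
    (fun _ _ _ => 0) (fun _ _ _ => 0) (fun _ _ _ => 0) (fun _ _ _ => 0)
    (c𝒢 := 0) (δ𝒢 := 0) (M𝒢 := 1) (cι := 0) (δι := 0) (Mι := 1) (cH := 0) (δH := 0) (MH := 1)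
    (cH₁ := 0) (δH₁ := 0) (MH₁ := 1)
    le_rfl zero_le_one (fun _ _ _ => by simp) (fun _ => by simp)
    le_rfl zero_le_one (fun _ _ _ => by simp) (fun _ => by simp)
    le_rfl zero_le_one (fun _ _ _ => by simp) (fun _ => by simp)
    le_rfl zero_le_one (fun _ _ _ => by simp) (fun _ => by simp)
    (fun _ _ => 0) (B₀w := 1) (C₄w := 0) (a₃w := 2 / 3) (ε₄w := 1 / 6) (bw := 1 / 6)
    (fun _ f => norm_kerOp_zero_le zero_le_one f) (fun _ => ⟨fun Y _ => by simp, differentiableOn_const _⟩) one_pos le_rfl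
    (by norm_num) (by norm_num) (by norm_num) (by norm_num) (fun _ B => norm_kerOp_zero_le zero_le_one B)
    (fun _ _ => 0) (rΦw := 1 / 3) (fun _ => differentiableOn_const _) (fun _ => rfl)
    (fun _ z _ => by simp) (by linarith)
    (fun _ _ => 0) (C₂w := 0) (RCw := 2) le_rfl (fun _ Z _ => by simp) (fun _ => differentiableOn_const _)
    (fun _ Y => by simpa using norm_kerOp_zero_le zero_le_one Y) (fun _ X => norm_kerOp_zero_le zero_le_one X)
    (by norm_num) (by norm_num)
    (fun _ _ => True) (fun _ A A' c' _ => rfl) (rW := 0) (fun _ _ _ => by simp)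
    (fun _ _ => True) (fun _ A A' c' _ => rfl) (rC := 0) (fun _ _ _ => by simp)
    (fun _ z i _ => rfl) (by norm_num) (by norm_num)
    (𝔭 := Unit) {()} (fun _ => [0]) (fun _ => ∅) (fun _ => 0)
    (fun _ _ ℓ _ A A' _ => by simp_all) (fun _ _ b' hb' => absurd hb' (Finset.notMem_empty _)) (fun _ _ => le_rfl)
    (κwb := 1) (κcb := 1) zero_le_one zero_le_one
    (fun _ _ ℓ hℓ => by
      rw [List.mem_singleton.1 hℓ]; exact ContinuousLinearMap.opNorm_le_bound _ zero_le_one fun Y => by simp)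
    (fun _ _ => by
      rw [List.sum_cons, List.sum_nil, add_zero]
      exact ContinuousLinearMap.opNorm_le_bound _ zero_le_one fun Y => by simp)
    (mw := 1) (fun _ _ => by simp)
    ⊤ (by simp) ⊤ ⊤ ⊤ (by simp) ⊤
    (fun _ f _ => AddSubgroup.mem_top _) (fun _ Y _ => AddSubgroup.mem_top _) (fun _ Y _ => AddSubgroup.mem_top _)
    (fun _ X _ => AddSubgroup.mem_top _) (fun _ Z _ => AddSubgroup.mem_top _) (fun _ B _ => AddSubgroup.mem_top _)
    (fun _ y _ => AddSubgroup.mem_top _)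
    (fun _ _ ℓ hℓ Y _ => by rw [List.mem_singleton.1 hℓ]; simp)
    (fun _ _ => 1) (d := fun _ => 0) (dbar := 0) (fun _ _ _ => (unitary _).one_mem) (fun _ _ _ => by simp)
    (fun _ _ => le_rfl) le_rfl (Kw := 1) (by simp)
    -- ══ (T3): S80 f4's data VERBATIM ══
    (Λe := Unit) (𝔄 := ℂ) (δ' := 0) (ϖ := fun _ => 0) le_rfl (fun _ => le_rfl)
    (𝒴e' := ℂ) (𝒳e := ℂ) (𝒵e := ℂ) (ℬe := ℂ)
    (fun _ => 0) (fun _ _ => 0) (B₀e := 1) (C₄e := 0) (a₃e := 2 / 3) (be := 1 / 6) (ε₄e := 1 / 6)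
    (fun _ f => by simp) (fun _ => ⟨fun Y _ => by simp, differentiableOn_const _⟩) one_pos le_rfl (by norm_num)
    (by norm_num) (by norm_num) (by norm_num) (by norm_num)
    (fun _ => 0) (fun _ B => by simp) (fun _ _ => 0) (rΦe := 1 / 3) (fun _ => differentiableOn_const _)
    (fun _ => rfl) (fun _ z _ => by simp) (by linarith)
    (fun _ _ => 0) (C₂e := 0) (RCe := 1) le_rfl (fun _ Z _ => by simp) (fun _ => differentiableOn_const _)
    (fun _ => 0) (fun _ Y => by simp) (fun _ => 0) (fun _ X => by simp) (by norm_num) (by norm_num)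
    (𝔱 := Unit) {()} (Ef := fun _ _ => 0) (rE := 1) (ee := fun _ => 0) one_pos
    (fun _ _ => differentiableOn_const _) (fun _ _ Z _ => by simp) (fun _ _ => le_rfl)
    (fun _ => ∅) (fun _ _ A₁ A₂ _ => rfl) (fun _ => 0) (fun _ _ b' hb' => absurd hb' (Finset.notMem_empty _))
    (LK := 0) le_rfl (by simp) (by norm_num) (BE₁ := 0) (fun _ y _ => by simp)
    -- ══ (S78): S80 f4's data VERBATIM ══
    (Ω := Unit) (Measure.dirac ()) (g := fun _ => 1) (fun _ => zero_le_one) (fun _ _ _ => 0) (Bd := 0) le_rfl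
    (fun _ x _ c' _ _ => by simp)
    (fun _ x _ c' _ _ => by simp) (fun _ x _ c' _ _ ω => by simp) (BE₂ := 0) (fun _ y _ => by simp)
    -- ══ the (T1) real structure ON THE BLOCK SPACE and S88's dictionary READ THROUGH IT ══
    {rdL d η} ⊤ ⊤ ⊤ (by simp) (readOutReal {toyReadOut p e})
    (fun _ f _ => ?_) (fun _ Y _ => AddSubgroup.mem_top _)
    (fun _ Y _ => AddSubgroup.mem_top _) (fun _ X _ => by simp)
    (fun _ Z _ => AddSubgroup.mem_top _) (fun _ B hB => ?_)
    (fun _ y _ => ?_) (fun V x hx => ?_) (fun V x hxu => ?_)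
    (fun V x hJ => ?_) (fun V x a ha => ?_) (fun V x => ?_) (fun _ => ShellMeasureLandauHolonomyPrint.chartCube_subset_closedBall hS.le)
    (by norm_num) (by norm_num) hρ0 (by linarith) le_rfl (η := η) (εθ := εθ₁ S η) (c₁ := 1 / (16 * η ^ 2))
    (c₂ := 1 / (16 * η)) (z := 1) hη (εθ₁_pos hS hη hSη) ?_ ?_ ?_ ?_
  · -- `h1`: `2·B₀·C₁·B₃·ε₁ ≤ ε₄` — equality `1∕32`
    rw [show 2 * (1 / (C₄c d + 1)) * 1 * 1 * ((C₄c d + 1) / 64) = (1 : ℝ) / 32 by field_simp; ring]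
  · -- `h3`: `16·B₀·C₄·ε₄ ≤ 1` with OUR `C₄`
    rw [show 16 * (1 / (C₄c d + 1)) * C₄c d * (1 / 32) = C₄c d / (2 * (C₄c d + 1)) by field_simp; ring]
    rw [div_le_one (by positivity)]; linarith
  · -- `hH₁`: `‖(B₀∕E₀)•embL B‖ ≤ B₀‖B‖`
    intro V B
    rw [smul_apply, norm_smul, Complex.norm_real, Real.norm_of_nonneg (by positivity)]
    calc (1 / (C₄c d + 1)) / (6 / η) * ‖embL d p e η B‖
        ≤ (1 / (C₄c d + 1)) / (6 / η) * (6 / η * ‖B‖) :=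
          mul_le_mul_of_nonneg_left (norm_embL_le d p e hη hη1 B) (by positivity)
      _ = 1 / (C₄c d + 1) * ‖B‖ := by field_simp
  · -- `hΦ`: `‖(E₀∕B₀)•z‖ < 2·dL·C₁·ε₁` on `‖z‖ < r_Φ`
    intro V z hz
    rw [mem_ball_zero_iff] at hz
    rw [norm_smul, Complex.norm_real, Real.norm_of_nonneg (by positivity)]
    calc (6 / η) / (1 / (C₄c d + 1)) * ‖z‖ < (6 / η) / (1 / (C₄c d + 1)) * (η / 192) :=
          mul_lt_mul_of_pos_left hz (by positivity)
      _ = 2 * 1 * 1 * ((C₄c d + 1) / 64) := by field_simp; ring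
  · -- `hcoup`: `ε₄ + B₀·(2dLC₁ε₁) ≤ ε₃` — equality `1∕16`
    rw [show (1 : ℝ) / 32 + 1 / (C₄c d + 1) * (2 * 1 * 1 * ((C₄c d + 1) / 64)) = 1 / 16 by field_simp; ring]
  · -- `h𝒢r`: the read-out never sees the propagator letter (`rdL ∘ 𝒢 = 0`)
    intro ℓ hℓ
    rw [Set.mem_singleton_iff.1 hℓ, rdL_𝒢L d h01]
    exact (skewAdjoint M₂).zero_mem
  · -- `hH₁r`: the scaled embedded letter is read skew-adjoint when the chart letter is
    intro ℓ hℓ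
    rw [Set.mem_singleton_iff.1 hℓ, smul_apply, map_smul, rdL_embL]
    exact real_smul_mem_skewAdjoint (hB (toyReadOut p e) (Set.mem_singleton _)) _
  · -- `hΦr`: `Φ (cplx y)` is read skew-adjoint by S88's letter
    intro ℓ hℓ
    rw [Set.mem_singleton_iff.1 hℓ, map_smul, toyReadOut_cplx]
    exact real_smul_mem_skewAdjoint (gen_mem_skewAdjoint _ _ _ _) _
  · -- `hRdict`: the three DEFINED profiles vanish on the degenerate (T2)∕(T3)∕(S78) data (S80 f4 VERBATIM)
    rw [fixTo_empty, toyJco, indicator_of_mem hx]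
    simp
  · -- `hudict`: S88's dictionary READ THROUGH THE BLOCK SPACE — `rdL (H₁ (Φ (cplx x))) = gen x`
    have h1 : expFibreChart {b₁ p} (1 : GaugeField P j SU2) e x ⟨b₁ p, Finset.mem_singleton_self _⟩ =
        expPt (fun i => x (e (⟨b₁ p, Finset.mem_singleton_self _⟩, i))) :=
      show (1 : SU2) * _ = _ from one_mul _
    have hsc : ((((1 / (C₄c d + 1)) / (6 / η) : ℝ) : ℂ) • embL d p e η)
        ((((6 / η) / (1 / (C₄c d + 1)) : ℝ) : ℂ) • cplx x) = embL d p e η (cplx x) := by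
      rw [smul_apply, map_smul, smul_smul, ← Complex.ofReal_mul,
        show (1 / (C₄c d + 1)) / (6 / η) * ((6 / η) / (1 / (C₄c d + 1))) = (1 : ℝ) by field_simp, Complex.ofReal_one,
        one_smul]
    -- the minimiser correction is a GENUINE fixed point fed by OUR `blockW`, and the read-out does not see it
    have hxS : ‖x‖ ≤ S := mem_closedBall_zero_iff.1 (ShellMeasureLandauHolonomyPrint.chartCube_subset_closedBall hS.le hxu)
    have h𝔄 : ‖embL d p e η (cplx x)‖ < 1 / 32 :=
      calc ‖embL d p e η (cplx x)‖ ≤ 6 / η * ‖cplx x‖ := norm_embL_le d p e hη hη1 _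
        _ ≤ 6 / η * S := mul_le_mul_of_nonneg_left ((norm_cplx_le x).trans hxS) (by positivity)
        _ < 6 / η * (η / 192) := mul_lt_mul_of_pos_left hSη (by positivity)
        _ = 1 / 32 := by field_simp; ring
    have hsol : rdL d η (solAt (𝒢L d η (1 / (C₄c d + 1) * η / 2)) 0 (blockW d η) (1 / 32) (0 : 𝕎 d)
        (embL d p e η (cplx x))) = 0 :=
      rdL_solAt_eq_zero d h01 h𝒢B (blockW_prop4Hyp d hd1 hη hη1) hB₀.le hC h𝔄 (by norm_num) (by norm_num)
        (by
          rw [show 1 / (C₄c d + 1) * C₄c d * (1 / 32 + 1 / 32) ^ 2 = C₄c d / (256 * (C₄c d + 1)) by field_simp; ring]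
          rw [div_le_iff₀ (by positivity)]; nlinarith)
        (by
          rw [show 4 * (1 / (C₄c d + 1)) * C₄c d * (1 / 32 + 1 / 32) = C₄c d / (4 * (C₄c d + 1)) by field_simp; ring]
          rw [div_lt_one (by positivity)]; linarith)
    rw [fixTo_empty, toyU, dist1_plaqHol_section, dist1_eq_norm_coe_sub_one, ← h1, coe_chart]
    simp only [classifier, Finset.sup'_singleton, holOf_apply, List.map_cons, List.map_nil, wordExp_cons, wordExp_nil,
      mul_one, landauExp_zero, hsc, map_add, hsol, zero_add, rdL_embL, toyReadOut_cplx]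
  · -- `hJW`
    by_contra h
    exact hJ (indicator_of_notMem h _)
  · -- `hJ`
    unfold toyJco
    by_cases hx : x ∈ cube m₀ S
    · rw [indicator_of_mem hx, indicator_of_mem (smul_mem_cube hx ha)]
      exact toyF_section_mono hSπ p e V hx ha
    · rw [indicator_of_notMem hx]; exact bot_le
  · -- `hJ1`
    unfold toyJco
    by_cases hx : x ∈ cube m₀ S
    · rw [indicator_of_mem hx]; exact toyF_le_one S p _
    · rw [indicator_of_notMem hx]; exact bot_le
  · -- `hs₁`: curl read-out × field size — `1·(1∕16) ≤ (1∕(16η²))·η²·1`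
    rw [show (1 : ℝ) * ((1 / 32 + 1 / (C₄c d + 1) * (2 * 1 * 1 * ((C₄c d + 1) / 64))) +
        1 / (C₄c d + 1) * (4 * 0 * (1 / 32 + 1 / (C₄c d + 1) * (2 * 1 * 1 * ((C₄c d + 1) / 64))) ^ 2)) = 1 / 16 by
      field_simp; ring]
    rw [show 1 / (16 * η ^ 2) * η ^ 2 * 1 = (1 : ℝ) / 16 by field_simp]
  · -- `ha`: letter size
    rw [show (1 : ℝ) * ((1 / 32 + 1 / (C₄c d + 1) * (2 * 1 * 1 * ((C₄c d + 1) / 64))) +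
        1 / (C₄c d + 1) * (4 * 0 * (1 / 32 + 1 / (C₄c d + 1) * (2 * 1 * 1 * ((C₄c d + 1) / 64))) ^ 2)) = 1 / 16 by
      field_simp; ring]
    rw [show 1 / (16 * η) * η * 1 = (1 : ℝ) / 16 by field_simp]
  · -- `hma`: regime `m·κ_r·a ≤ 1`
    rw [show ((1 : ℕ) : ℝ) * (1 * ((1 / 32 + 1 / (C₄c d + 1) * (2 * 1 * 1 * ((C₄c d + 1) / 64))) +
        1 / (C₄c d + 1) * (4 * 0 * (1 / 32 + 1 / (C₄c d + 1) * (2 * 1 * 1 * ((C₄c d + 1) / 64))) ^ 2))) = 1 / 16 by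
      field_simp; ring]
    norm_num
  · -- `hsm`: (SM) with equality by the choice of `εθ₁`
    unfold εθ₁
    rw [show (1 : ℝ) / 2 * (72 * (1 / (16 * η ^ 2) * 1 + ((1 : ℕ) : ℝ) ^ 2 * (1 / (16 * η)) ^ 2 * 1 ^ 2) /
        ((η / 192) / S - 1) ^ 2) = 36 * (1 / (16 * η ^ 2) * 1 + ((1 : ℕ) : ℝ) ^ 2 * (1 / (16 * η)) ^ 2 * 1 ^ 2) /
        ((η / 192) / S - 1) ^ 2 by ring]

/-- **«(P4) JOINTLY» — CLEAN FORM**: the same with the slot constant `4·m₀` (the degenerate (T2)∕(T3)∕(S78) budgets vanish).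
[folklore] -/
theorem slotAC_assembled_decay_blockP4 [DecidableEq (PBond P j)] (p : Plaq P j) {m₀ : ℕ}
    (e : ↥({b₁ p} : Finset (PBond P j)) × Fin 3 ≃ Fin m₀) (d : ℕ) [NeZero d] (hd2 : 2 ≤ d) {η S ρ : ℝ} (hη : 0 < η)
    (hη1 : η ≤ 1) (hS : 0 < S) (hSη : S < η / 192) (hρ0 : 0 ≤ ρ) (hρ4 : ρ ≤ 1 / 4) :
    SlotAntiConcentration ((fieldMeasure P j SU2).withDensity (toyF S p)) (toyU p) (εθ₁ S η * η ^ 2) ρ (4 * m₀) := by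
  have h := slotAC_assembled_decay_blockP4_lit p e d hd2 hη hη1 hS hSη hρ0 hρ4
  convert h using 2
  simp only [abs_zero, zero_mul, mul_zero, zero_div, zero_add, add_zero]
  ring

/-- **THE LIVE-LEVEL INSTANCE, LITERALLY**: `d = 4`, `η = 1∕2` (window `0 < S < 1∕384`). [folklore] -/
example [DecidableEq (PBond P j)] (p : Plaq P j) {m₀ : ℕ} (e : ↥({b₁ p} : Finset (PBond P j)) × Fin 3 ≃ Fin m₀) {S ρ : ℝ}
    (hS : 0 < S) (hS' : S < (1 / 2 : ℝ) / 192) (hρ0 : 0 ≤ ρ) (hρ4 : ρ ≤ 1 / 4) :=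
  slotAC_assembled_decay_blockP4 p e 4 (by norm_num) (η := 1 / 2) (by norm_num) (by norm_num) hS hS' hρ0 hρ4

end End

end Summit.QuantumFields.BalabanUV.T4Continuum.ShellMeasureLandauEndAssembledBlockP4

end
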